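import Mathlib
import HarnessLib
import HarnessLib.Audit
import Summits.Ventures.CertifiedManyBodySolver.HubbardAlg.MbsolverRungLeaves

/-!
Route: M3PrimeEdgeSplitTpm1o4

DORMANT since 2026-09-03T15:46:39Z (reconciler: no traction for 5 d (last activity route-revised at 2026-08-29T15:10:44Z); parked, not closed — `ledger route dormant route-Ventures-M3PrimeEdgeSplitTpm1o4 --off` to reactivate) — unstaffed, not closed; items shared with open routes are served there. `ledger route dormant <id> --off` reactivates.

# Route M3PrimeEdgeSplitTpm1o4 — M3′ at the t′ = −1/4 companion cell (8, 7/8, −1/4) as a declared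
edge split — certified upper ≤ −3/4 and certified lower ≥ −4/5 decide the split leaf (lower ∧ upper;
window width exactly 1/20)

It suffices to show X = UpperEdgeTpm1o4_le_m3o4 ∧ LowerEdgeTpm1o4_ge_m4o5: at (U, n, t′) = (8, 7/8,
−1/4) the thermodynamic-limit energy
density e′ = `energyDensityTT' 1 (-1/4) 8 (7/8)` of the t–t′ square-lattice Hubbard model has a
CERTIFIED UPPER row `e′ ≤ hi`, `hi ≤ −3/4`,
and a CERTIFIED LOWER row `lo ≤ e′`, `−4/5 ≤ lo`. The pair IS the declared-split rung leaf
`MbsolverRungLeaves.M3Split_tpm1o4_M3prime`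
(:= M3Lower_tpm1o4_ge_m4o5 ∧ M3Upper_tpm1o4_le_m3o4, tree l.318; both conjuncts are verbatim the
threshold leaves l.312 / l.306); its window
[−4/5, −3/4] has width exactly 1/20 = `M3Width`, so it implies the ∃-window leaf
`M3Window_tpm1o4_M3prime` = M3′(b) of the venture — that
leaf is classically inhabited (density of ℚ), bookkeeping only; no closure of a window leaf is rung
progress. D-0145 LINES registration
(director-hubbard g11 R-GRID: the t′-companion GRID cell is the one generic-cell class that HAS
registered leaves; the other GRID §1 cells have
none and are deferred). HONEST FRAMING: first certified bounds; not a superconductivity verdict; no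
dated object reaches either edge (cell of
record [#504, #644] = [−0.8341460554, −0.7100063817], width 0.1241396737 = ×2.48 of M3′ since
CERTIFIED #644 / MOVE 238, 2026-08-29T15:07:10Z — refreshed by the lines seat g8; was [#504, #596] =
[−0.8341460554, −0.7044867583], 0.1296592971 = ×2.59 since MOVE 190 2026-08-29T04:39Z, and [#504,
#445] = [−0.8341460554, −0.6866417849], 0.1475042705 = ×2.95 before); the float reference at this t′
is itself weak (NO
unbiased TL number in print); rungs are rungs.
ATTACKED / RESIDUAL (D-0033 header; J S1 supplement sha16 c8d5abb819db969d, ROUND 1 PASS · FRONTIER,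
replayed 2026-08-28T06:51:15Z; director-hubbard ENDORSE REQUESTS l.27442): ATTACKED = the UPPER edge
`UpperEdgeTpm1o4_le_m3o4` (stmt-Ventures-22283) — producers var-tpm / BD-STRIP (best certified #644
hi = −1561320545012/2⁴¹ = −390330136253/2³⁹ = −0.7100064, gap 0.0399936 — the O3 (iii)(b) «HEALTHY
t′ CELL PAIR» COMPANION-cell UPPER RE-CEILING = «bd-strip-plaqseam-v1» plaquette-seam exact-cert
W4tpO3iiD1192_x02 at t′ = −¼ (hubbard-upper-eng-1 g16 on hubbard-upper-eng-2 g10's O3 (ii)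
re-optimised W = 4 floor cell, D 1192–1200), QUALITY label «HEALTHY t′ cell …, dressed by eng-1
g16's plaqseam (iii)(b)» verbatim in the row, referee ref-12 g37 R12.49, mbsolver INBOX l.32702;
Lean node LANDED p728077 2026-08-29T15:08:44Z:
`Certificates.m3_tpm1o4_upper_plaqseam_W4tpO3iiD1192_x02_of` from the open claim node
`cert_plaqseam_W4tpO3iiD1192_x02_allmk` (lit-4 g33,
`Certificates/HubbardSquare_n7o8_upper_plaqseam_W4tpO3iiD1192_x02_row644.lean`, mbsolver INBOX
l.32716; #596 superseded BY NAME `m3_tpm1o4_upper_r596_of_r644`; signer's by-name audit invited; a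
certificate replay in the #596 node's grammar, not an item of this route); it supersedes #596 hi =
−774591382429/2⁴⁰ = −0.7044868 (gap 0.0455132) by 6068890077/2⁴⁰ = 0.0055196, whose node
`Certificates.m3_tpm1o4_upper_plaqseam_W4tpm1o4D1200weak_x01_of` (p696900, from the open claim node
`cert_plaqseam_W4tpm1o4D1200weak_x01_allmk`; ref-12 g34 by-name audit PASS l.30692) stays a dated
in-tree rung, as does #445 hi = −12079530027017/2⁴⁴ = −0.6866418 (all-k node
`M3Upper_tpm1o4_floor445_of`, the BC5 witness of record); S-case `M3Upper_tpm1o4_le_m3o4` open; J: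
truth-risk MODERATE on −3/4 at t′ = −1/4 — converged float first); RESIDUAL = the LOWER edge
`LowerEdgeTpm1o4_ge_m4o5` (stmt-Ventures-22284) = complement conjunct in the D-0033 sense only — it
stays an item and the closer-list rung `M3Lower_tpm1o4_ge_m4o5` (hub-lb; best certified #504 O1 lo =
−0.8341461, gap 0.0341461; in-tree rung `rungLeaf_M3Lower_tpm1o4_floorO1_of_r504`); no difficulty
claim either way. JUDGED AGAINST `MbsolverRungLeaves.M3Split_tpm1o4_M3prime`: `closes` RE-POINTED
there at rev 3 (2026-08-28T06:42Z, alt_closers rung M3wtpm); route OPEN since the round-1 replay.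
Lean: `(∃ hi : ℚ, hi ≤ (-3/4 : ℚ) ∧ Summit.Ventures.CertifiedManyBodySolver.M3EnergyUpperRow (-1/4)
hi) ∧ (∃ lo : ℚ, (-4/5 : ℚ) ≤ lo ∧ Summit.Ventures.CertifiedManyBodySolver.M3EnergyLowerRow (-1/4)
lo)`

## Assembly
Pure logic: the deciding theorem is `closes (h₂ : UpperEdgeTpm1o4_le_m3o4) (h₃ :
LowerEdgeTpm1o4_ge_m4o5) : MbsolverRungLeaves.M3Split_tpm1o4_M3prime
:= ⟨h₃, h₂⟩` in glue.lean (the split leaf is literally lower ∧ upper). The Assembly item below is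
the older implication to the ∃-window leaf as a Prop
(witnesses hi ≤ −3/4 and lo ≥ −4/5 give `M3EnergyRow (−1/4) lo hi` by `M3EnergyRow_iff` and `M3Width
lo hi` by `linarith`; exempt, not the deciding theorem).

CLOSES_TARGET: closes rung M3wtpm of Ventures/CertifiedManyBodySolver: Summit.Ventures.CertifiedManyBodySolver.MbsolverRungLeaves.M3Split_tpm1o4_M3prime (D-0061; not the summit Statement) — the deciding theorem of this route concludes that registered leaf (Ventures/CertifiedManyBodySolver: no summit Statement) (class rung: servable and labelled, never counted as concluding the summit Statement).

Rationale: WHY THIS LINE. M3′(b) asks for the same 0.05·t window at the t′ = −1/4 companion point; as typed the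
leaf is a window-EXISTENCE sentence and classically
inhabited (density of ℚ; venture Statement D-8; kernel witness
`LinesSeatAudit.M3Window_tpm1o4_M3prime_vacuous` in this seat's folder), so
the route DECLARES the split and the edges carry the content. The split [−4/5, −3/4] is the t′ = 0
split of route M3PrimeEdgeSplit carried
over: the only references at t′ ≈ −1/4 are DMRG width-4 cylinders −0.76965(2) (JiangDevereaux2019,
t′ = −0.25), DMET TL −0.771(15) at t′ = −0.2
(LeBlancEtAl2015 ancillary) and VMC 40 × 6 tori −0.7322 (upper-type; arXiv:2403.02073), i.e. e′ ≈
−0.77 ± 0.015 sits inside with margins ≈ 0.03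
below / 0.02 above — thinner and less certain than at t′ = 0, which is exactly why a CERTIFIED pair
is worth more here (no unbiased number exists
in print to compare methods against). The producers and transports are the t′-twins of the t′ = 0
programme: t–t′ open-box all-k families
(CERTIFIED #445, pair-seam dressed 32 × 4k tiling, −0.6866; CERTIFIED #596, one-plaquette-layer
dressed W = 4 glide TI cell at t′ = −¼, −0.7045, 2026-08-29; CERTIFIED #644, the same dressing on
the re-optimised («healthy») W = 4 cell, −0.7100, 2026-08-29) transported by
`Upper.DressedBoxTiling.energyDensityTT'_le_of_tiling_rat` with
`t' = -1/4` (the diagonal bonds across box seams are dropped as well, Ruelle1969 §3.3), and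
translation-invariant moment/SOS relaxations with
exact rational duals (#448 −0.8473; O1 K8c object −0.8341 unsigned) transported by
`ThermodynamicLimit.energyDensityTT'_ge_of_eventually_ge_torus`
(Han2020Bootstrap §3, WangEtAl2024). Both edges are far today (upper needs −0.0400 after #644, was
−0.0455 after #596 and −0.063 vs #445; lower +0.034 over O1 = #504): this is the programme route for
the
companion cell, not a near-term rung; the near-term t′ leaves (`M3Window_tpm1o4_le_1476e4`,
`M3Lower_tpm1o4_floorO1`) are certificate-replay
tasks with no open mathematics and are therefore NOT given routes.

RANKED CRUXES. #2 UpperEdgeTpm1o4_le_m3o4 (crux) — some certified thermodynamic-limit UPPER row at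
(8, 7/8, −1/4) at or below −3/4: ∃ hi ∈ ℚ, hi ≤ −3/4 ∧ e′ ≤ hi. Producers: t–t′ open strips of width
≥ 12 / seam-correlated 2-D tilings at certifiable bond dimension (t′ upper objects of record: W = 4
pair-seam tiling #445 −0.6866 at birth and, since 2026-08-29, the one-plaquette-layer dressed W = 4
glide TI cell #596 −0.7045 and its re-optimised-cell twin #644 −0.7100 — 0.0400 short; the t′ = −1/4
diagonal bonds lost at every seam cost more than at t′ = 0). [difficulty: XL] (why it might fail:
only 0.02 above a WEAK float reference (DMRG width-4 −0.7697, DMET −0.771(15) at t′=−0.2; VMC tori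
only −0.732): if e′ > −0.75 the crux is false; and t′ seams lose diagonal bonds, so open families
converge slower than at t′ = 0 (today −0.687 vs −0.712).) [JiangDevereaux2019, LeBlancEtAl2015,
arXiv:2403.02073, Ruelle1969]
#3 LowerEdgeTpm1o4_ge_m4o5 (crux) — some certified thermodynamic-limit LOWER row at (8, 7/8, −1/4)
at or above −4/5: ∃ lo ∈ ℚ, −4/5 ≤ lo ∧ lo ≤ e′. Producers: the (t′)-twin JOINT/K8c moment
relaxations (O1 −0.8341 unsigned, #448 −0.8473 certified); needs +0.034 over O1, i.e. a T2-class
footprint as at t′ = 0. [difficulty: XL] (why it might fail: +0.034 over the best (unsigned) t′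
lower O1 and +0.047 over certified #448; degree-4 SOS misses 2nd-order PT (Hastings2022) and each
+0.01 costs ≈×10 in relaxation size; false if e′ < −0.8 (float margin ≈ 0.03 on a weak reference).)
[Han2020Bootstrap, Hastings2022, WangEtAl2024, JiangDevereaux2019]

TWO-LAYER PLAN. Foreseen (BC3 birth skeletons, nothing filed now): UpperEdgeTpm1o4_le_m3o4 ⇐
StripFamilyTpm1o4_le_m3o4 (certified all-k open t–t′ family at
filling 7/8, endpoint ≤ −3/4) → TilingTransport (t′ = −1/4 instance of
`energyDensityTT'_le_of_tiling_rat`, provable now);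
LowerEdgeTpm1o4_ge_m4o5 ⇐ TorusFloorTpm1o4_m4o5 (uniform tilted torus floor −4/5) → FloorTransport
(`energyDensityTT'_ge_of_eventually_ge_torus`,
provable now). Rungs by name (plan-only): `M3Upper_tpm1o4_floor445`, `M3Lower_tpm1o4_floor448`,
`M3Lower_tpm1o4_floorO1` (certificate replays; all three have in-tree cert-hypothesis closers today:
`M3Upper_tpm1o4_floor445_of`, `M3Lower_tpm1o4_floor448_of`,
`rungLeaf_M3Lower_tpm1o4_floorO1_of_r504`). CERTIFIED #596 (−774591382429/2⁴⁰) has its Lean node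
since 2026-08-29T04:48Z (p696900, lit-4 g31,
`Certificates/HubbardSquare_n7o8_upper_plaqseam_W4tpm1o4D1200weak_x01_row596.lean`:
`m3_tpm1o4_upper_plaqseam_W4tpm1o4D1200weak_x01_of : cert_plaqseam_W4tpm1o4D1200weak_x01_allmk →
M3EnergyUpperRow (-1/4) (−774591382429/2⁴⁰)`; two-sided with #504 BY NAME
`m3_tpm1o4_row_r504_plaqseam_W4tpm1o4D1200weak_x01_of` / `_width`; #445's sentence re-derived
`m3_tpm1o4_upper_r445_of_r596`; leaves re-closed
`rungLeaf_M3Upper_tpm1o4_floor445_of_plaqseam_W4tpm1o4D1200weak_x01` (rung) and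
`rungLeaf_M3Window_tpm1o4_le_1476e4_of_r504_plaqseam_W4tpm1o4D1200weak_x01` (window bookkeeping, not
rung progress); ref-12 g34 by-name audit PASS) — a dated rung of the attacked conjunct
(MbsolverRungLeaves has no `floor596` leaf and none is asked here), not an item of this route unless
the VAR pen / LEAD word a typed aside (the route (a) #550/#580 grammar). CERTIFIED #644
(−1561320545012/2⁴¹, 2026-08-29T15:07:10Z) has its Lean node since 2026-08-29T15:08:44Z (p728077,
lit-4 g33, `Certificates/HubbardSquare_n7o8_upper_plaqseam_W4tpO3iiD1192_x02_row644.lean`: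
`m3_tpm1o4_upper_plaqseam_W4tpO3iiD1192_x02_of : cert_plaqseam_W4tpO3iiD1192_x02_allmk →
M3EnergyUpperRow (-1/4) (-390330136253/549755813888)`; #596's sentence re-derived
`m3_tpm1o4_upper_r596_of_r644`, #445's `m3_tpm1o4_upper_r445_of_r644`; leaf
`M3Upper_tpm1o4_floor445` re-closed
`rungLeaf_M3Upper_tpm1o4_floor445_of_plaqseam_W4tpO3iiD1192_x02`); same status: a dated rung of the
attacked conjunct once replayed, not an item.

KILL CRITERIA. A certified LOWER row at (8, 7/8, −1/4) with lo > −3/4 refutes the upper crux; a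
certified UPPER row with hi < −4/5 refutes the lower crux;
either closes the route `refuted:<Decl>` and M3′(b) is re-targeted to a shifted split by a new
route. An unbiased float TL number at
t′ = −1/4 landing outside [−0.80, −0.75] (e.g. AFQMC/DMRG extrapolations) does not refute but forces
the pivot before producers are spent.
Proof of route M3PrimeEdgeSplit (t′ = 0) does NOT moot this route (different point).

NOT DECOMPOSED YET. Everything below the two objects: which t′ upper class closes the remaining
0.0400 (was 0.0455 after #596, 0.063 after #445; W ≥ 12 t–t′ column states, diagonal-seam dressing),
which lower
edition passes −0.80; whether the split should move to [−0.81, −0.76] once an unbiased reference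
exists (that would be a new route).

CHEAPEST FALSIFIER. Lookup, run by this seat: (i) the leaf AS TYPED is classically inhabited
(`LinesSeatAudit.M3Window_tpm1o4_M3prime_vacuous`, folder Sketch.lean,
rc 0) — content = the two edges; (ii) no certified row crosses the split the wrong way (CERTIFIED
2026-08-29, 644 rows: lowers #448 −0.8473 / #504 −0.8341, uppers #445 −0.6866
/ #596 −0.7045 / #644 −0.7100 — none beyond −0.75 / −0.80; the #596-state and #644-state
witness-split / derived rows at other keys are not at this key's edges; re-dated by the lines seat
g8); (iii) float placement: DMRG width-4 −0.76965(2) (t′ = −0.25), DMET TL −0.771(15) (t′ = −0.2)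
inside [−0.80, −0.75]; the VMC torus
number −0.7322 is an upper-type variational energy on 40 × 6 and is NOT evidence that e′ > −0.75.
The cheapest real kill is an unbiased TL
extrapolation at t′ = −1/4 above −0.75.

NUMBERS. Split [−4/5, −3/4], width 1/20. Cell of record (t′ = −1/4; refreshed 2026-08-29 by the
lines seat g8 after CERTIFIED #644 / MOVE 238,
mbsolver INBOX l.32702 / l.32708; previous refresh g7 after #596 / MOVE 190, l.30660 / l.30663):
lower #504 = O1 −1008420703687177600106633/2⁸⁰ = −0.8341460554 (node
`Certificates.m3_tpm1o4_lower_r504_of`,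
cert-hypothesis `cert_r504_…_hanK8c2s_uprime`; leaf `M3Lower_tpm1o4_floorO1` via
`rungLeaf_M3Lower_tpm1o4_floorO1_of_r504`; signed ref-4 g162
2026-08-26); earlier lower #448 −256073130643150186533275/2⁷⁸ = −0.8472749163 (leaf
`M3Lower_tpm1o4_floor448`, `Certificates.m3_tpm1o4_lower_r448_of`);
upper #644 −1561320545012/2⁴¹ = −390330136253/2³⁹ (the referee's K = 41 dyadic ceiling; exact
bound/32 = −0.71000638172887…) = −0.7100063817 outward (O3 (iii)(b) «HEALTHY t′ CELL PAIR» (8, ⅞,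
−¼) UPPER: ⟨H(t = 1, t′ = −¼, U = 8)⟩/site at n = ⅞ of ONE explicit normalised W = 4 dressed strip
state — hubbard-upper-eng-2 g10's O3 (ii) re-optimised floor cell `cellcert_W4tpO3iiD1192_p8_cell`
(bd-strip-cell-v1 v1.1; N 32, W 4, Q [14,14], D 1192–1200, cell_int 9bc17c42…, kit j329070) dressed
by hubbard-upper-eng-1 g16's plaqseam (iii)(b) `plaqfinal_W4tpO3iiD1192_x02` (final kit j331688;
sha256 3b690c10eb31bdf3…); RESULT l.32293, var-2 g35 read-back EQUAL l.32298, var-1 g29 concordance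
l.32300; referee sr-mbsolver-ref-12 g37 R12.49 (HOME/REFEREE.md l.5157–l.5175, erratum R12.49a on
sha prefixes only) — independent-engine cell twin + own-code window legs, worst-of-both Θ ⇒ same
print; ROW BAR ≤ −0.7045867583 (var-1 l.31358) met by 0.0054196234; row writer sr-mbsolver-op-02
g63, AGREED sr-mbsolver-ref-2 g213 (l.32700); Lean node LANDED p728077 2026-08-29T15:08:44Z (lit-4
g33, commit 778b068f68ea,
`Certificates/HubbardSquare_n7o8_upper_plaqseam_W4tpO3iiD1192_x02_row644.lean`, mbsolver INBOX
l.32716; the #596 node's grammar): open claim node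
`Certificates.cert_plaqseam_W4tpO3iiD1192_x02_allmk` (the all-(m,k) strip-stack family of this
object on the open (8k) × (4m) box at (t, t′, U) = (1, −¼, 8)) ⇒
`m3_tpm1o4_upper_plaqseam_W4tpO3iiD1192_x02_of : cert_plaqseam_W4tpO3iiD1192_x02_allmk →
M3EnergyUpperRow (-1/4) (-390330136253/549755813888)`, with `cert_r644_endpoint_eq` /
`cert_r644_outward_print`; #596 superseded BY NAME (`m3_tpm1o4_upper_r644_lt_r596`,
`m3_tpm1o4_upper_r596_of_r644`, gain `m3_tpm1o4_upper_r596_sub_r644` = 6068890077/2⁴⁰) and #445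
re-derived `m3_tpm1o4_upper_r445_of_r644`; two-sided with #504 BY NAME
`m3_tpm1o4_row_r504_plaqseam_W4tpO3iiD1192_x02_of` / `_width`; leaves re-closed
`rungLeaf_M3Upper_tpm1o4_floor445_of_plaqseam_W4tpO3iiD1192_x02` (rung) and
`rungLeaf_M3Window_tpm1o4_le_1476e4_of_r504_plaqseam_W4tpO3iiD1192_x02` (window bookkeeping, not
rung progress); signer's by-name audit (ref-12 g38) invited, not yet posted at this refresh — an
energy CEILING of one state, an upper bound regardless of cut quality); it supersedes upper #596 by
6068890077/2⁴⁰ = 0.0055196234 — #596 stands as a rung: #596 −774591382429/2⁴⁰ (= −1549182764858/2⁴¹,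
K = 41) = −0.7044867583 outward («bd-strip-plaqseam-v1 (t′ = −¼)
one-plaquette-layer dressed TI-cell UPPER at (8,⅞,−¼)»: hubbard-upper-eng-1 g15 `final` kit j324807
on hubbard-upper-eng-2 g5's W = 4 glide TI cell
at t′ = −¼, cell certificate kit j323549; QUALITY label «WEAK glide cell (N 32, D 1 192, Q (14,14),
fit f 0.945, η − 1 = 5.7e-4), never
restart-tested» verbatim in the row — a certified ⟨H⟩ of one explicit normalised state is an upper
bound regardless of cut quality; referee
sr-mbsolver-ref-12 g34 R12.37 (HOME/REFEREE.md l.4781–l.4798); row writer op-02 g57, AGREED ref-2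
g211; certificate
`hubbard-upper-eng-1/certs/plaqfinal_W4tpm1o4D1200weak_x01.json` sha256 88b1918e31a304fe…; Lean node
LANDED p696900 2026-08-29T04:48Z (lit-4 g31): open claim node
`Certificates.cert_plaqseam_W4tpm1o4D1200weak_x01_allmk` (sector-pure all-(m,k) strip-stack family
on the open (8k) × (4m) box at (t, t′, U) = (1, −¼, 8), node literals outward: cc′ = cc exact, σ′ −
σ = 1.1e−12 ≥ 0, β′ = ⌈β⌉) ⇒ `m3_tpm1o4_upper_plaqseam_W4tpm1o4D1200weak_x01_of : … →
M3EnergyUpperRow (-1/4) (−774591382429/2⁴⁰)`, with `cert_r596_endpoint_eq` /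
`cert_r596_outward_print`; ref-12 g34 by-name audit PASS 13/13 + node-vs-cert 8/8, mbsolver INBOX
l.30692);
it supersedes upper #445 −12079530027017/2⁴⁴ = −0.6866417849 (leaf `M3Upper_tpm1o4_floor445`,
`Certificates.m3_tpm1o4_upper_dbt329pair_allk_of`)
by 313932091847/2⁴⁴ = 0.0178449733 — #445 stands as a rung. Width [#504, #644] =
150075656724049801379977/2⁸⁰ = 0.1241396737 outward
(×2.48 of 1/20; midpoint −0.7721, width = 16.08 % of |mid|), from [#504, #596] =
156748471931405685358729/2⁸⁰ = 0.1296592971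
(×2.59, of record since MOVE 190), [#504, #445] 178321721013769417130121/2⁸⁰ = 0.1475042705 (×2.95,
of record
since MOVE 112) and [#448, #445] 0.1606331313 (×3.21). Distances: upper edge needs −0.0399936183
more (21986724163/2³⁹; was −0.0455132417 vs #596, −0.0634 vs #445),
lower edge +0.0341460554 (#504) / +0.0472749163 (#448). NESTING (orientation only; no ordering of e₀
in t′ is certified, no phase word): the
t′ = 0 TARGET cell [#529, #580] = [−0.8295699476, −0.7249973335] lies inside [#504, #644]. Floats:
DMRG width-4 −0.76965(2)
(JiangDevereaux2019), DMET TL −0.771(15) at t′ = −0.2 (LeBlancEtAl2015 ancillary), VMC 40 × 6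
striped −0.7322 / uniform −0.7238
(arXiv:2403.02073).

DEFINITION REQUESTS. None.

Novelty: Searches (2026-08-27, shared with route M3PrimeEdgeSplit): corpus hybrid "rigorous certified
two-sided bounds ground state energy doped
Hubbard model thermodynamic limit semidefinite" (none certified); galaxy all "bootstrap|Hubbard
model|lower bound" (noise); galaxy pdf
"bootstrapping the Hubbard|many-body bootstrap|certified lower bound on the ground"
(arXiv:2507.02386, float); cell REFVALS §M3.b/§M3.f
(no unbiased TL energy at t′ = −0.2/−0.25 in print; acq-09259 pending for the Xu+ 2024 Science SM).
Nearest prior art found: the programme's rows #448/#445/O1 and leaves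
`M3Window_tpm1o4_le_1607e4/_1476e4`; JiangDevereaux2019
(arXiv:1806.01465) width-4 DMRG at t′ = −0.25; Han2020Bootstrap; WangEtAl2024.
Delta: the first typed statement of M3′(b) as a decided pair of declared thresholds at the t′
companion cell; a registration (crew rung
route), not a mechanism.
Claimed grade: known  [refs: 2507.02386, 1806.01465, JiangDevereaux2019, WangEtAl2024]

Barriers (technique_class: certified-upper-bound, sdp-lower-bound, cluster-tiling): - technique_class: certified-upper-bound, sdp-lower-bound, cluster-tiling
- Literature.Barriers.HubbardSuperconductivity.SignProblemNPHard: outside its class — nothing is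
sampled (explicit state / exact dual functional); t′ ≠ 0 worsens QMC sign problems but is invisible
to certificates.
- Literature.Barriers.HubbardSuperconductivity.DegreeFourSosMissesSecondOrderPerturbation: inside
its class for the LOWER crux; −0.80 is ≈0.03 below e′, not exactness; the bet is a T2-class
footprint with degree-6 fragments passes it.
- Literature.Barriers.HubbardSuperconductivity.PureModelStripeCompetition: prices the UPPER crux (t′
< 0 shifts stripe filling/period — partially filled stripes, Xu+ 2024 — so supercells must be chosen
t′-aware); energies only, validity untouched.
- Literature.Barriers.HubbardSuperconductivity.EnergyWindowCeilingResolution: not applicable (no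
observable ceiling claimed).
- Literature.Barriers.HubbardSuperconductivity.OrderParameterInvisibleToGroundStateConstraints:
conceded, irrelevant (energies only).
- Negatives index: `ledger negatives --problem Ventures` — no refuted statement concerns an (8, 7/8,
−1/4) energy threshold.

History (route lifecycle, newest last):
- 2026-08-28T06:34:30Z · closes_target -> closes rung M3wtpm of Ventures/CertifiedManyBodySolver: Summit.Ventures.CertifiedManyBodySolver.MbsolverRungLeaves.M3Split_tpm1o4_M3prime (D-0061; not the summit Statement) (planner-hubbard-m3-lines-1-g3-0)
- 2026-08-28T06:35:34Z · closes_target -> closes rung M3wtpm of Ventures/CertifiedManyBodySolver: Summit.Ventures.CertifiedManyBodySolver.MbsolverRungLeaves.M3Split_tpm1o4_M3prime (D-0061; not the summit Statement) (planner-hubbard-m3-lines-1-g3-0)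
- 2026-08-28T06:39:04Z · closes_target -> closes rung M3wtpm of Ventures/CertifiedManyBodySolver: Summit.Ventures.CertifiedManyBodySolver.MbsolverRungLeaves.M3Split_tpm1o4_M3prime (D-0061; not the summit Statement) (planner-hubbard-m3-lines-1-g3-0)
- 2026-08-28T06:40:47Z · closes_target -> closes rung M3wtpm of Ventures/CertifiedManyBodySolver: Summit.Ventures.CertifiedManyBodySolver.MbsolverRungLeaves.M3Split_tpm1o4_M3prime (D-0061; not the summit Statement) (planner-hubbard-m3-lines-1-g3-0)
- 2026-09-03T15:46:39Z · DORMANT — reconciler: no traction for 5 d (last activity route-revised at 2026-08-29T15:10:44Z); parked, not closed — `ledger route dormant route-Ventures-M3PrimeEdgeSpli (operator:999:892256)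

sub-problem: CertifiedManyBodySolver · status: dormant · opened planner-hubbard-m3-lines-1-g0-0 2026-08-27T20:41:18Z · rev 8 · ledger route-Ventures-M3PrimeEdgeSplitTpm1o4
GENERATED by the gate from the ledger (D-0016/17). Provers cite these decls: `theorem foo : Summit.Ventures.CertifiedManyBodySolver.Theses.M3PrimeEdgeSplitTpm1o4.<Decl> := …` in Summits/Ventures/CertifiedManyBodySolver/Theorems/<Name>.lean.
-/

namespace Summit.Ventures.CertifiedManyBodySolver.Theses.M3PrimeEdgeSplitTpm1o4

open scoped BigOperators Topology Manifold Classical MeasureTheory ProbabilityTheory Matrix InnerProductSpace ComplexConjugate ContinuousMap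
open Filter Set Function TopologicalSpace MeasureTheory

-- H21.Audit: Ventures rung route — no summit Statement decl; the expected conclusion is the closer leaf tagged below
attribute [summit_statement] _root_.Summit.Ventures.CertifiedManyBodySolver.MbsolverRungLeaves.M3Split_tpm1o4_M3prime

/-- item stmt-Ventures-22283 · crux · rank 2 · open · by planner
why it might fail: only 0.02 above a WEAK float reference (DMRG width-4 −0.7697, DMET −0.771(15) at t′=−0.2; VMC tori only −0.732): if e′ > −0.75 the crux is false; and t′ seams lose diagonal bonds, so open families converge slower than at t′ = 0 (today −0.687 vs −0.712).
sources: JiangDevereaux2019, LeBlancEtAl2015, arXiv:2403.02073, Ruelle1969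
[crux] some certified thermodynamic-limit UPPER row at (8, 7/8, −1/4) at or below −3/4: ∃ hi ∈ ℚ, hi
≤ −3/4 ∧ e′ ≤ hi. Producers: t–t′ open strips of width ≥ 12 / seam-correlated 2-D tilings at
certifiable bond dimension (today's t′ upper objects are W = 4 pair-seam tilings at −0.6866, 0.063
short; the t′ = −1/4 diagonal bonds lost at every seam cost more than at t′ = 0). [difficulty: XL] -/
@[route_item "route-Ventures-M3PrimeEdgeSplitTpm1o4"]
def UpperEdgeTpm1o4_le_m3o4 : Prop :=
  ∃ hi : ℚ, hi ≤ (-3/4 : ℚ) ∧ Summit.Ventures.CertifiedManyBodySolver.M3EnergyUpperRow (-1/4) hi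

/-- item stmt-Ventures-22284 · crux · rank 3 · open · by planner
why it might fail: +0.034 over the best (unsigned) t′ lower O1 and +0.047 over certified #448; degree-4 SOS misses 2nd-order PT (Hastings2022) and each +0.01 costs ≈×10 in relaxation size; false if e′ < −0.8 (float margin ≈ 0.03 on a weak reference).
sources: Han2020Bootstrap, Hastings2022, WangEtAl2024, JiangDevereaux2019
[crux] some certified thermodynamic-limit LOWER row at (8, 7/8, −1/4) at or above −4/5: ∃ lo ∈ ℚ,
−4/5 ≤ lo ∧ lo ≤ e′. Producers: the (t′)-twin JOINT/K8c moment relaxations (O1 −0.8341 unsigned,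
#448 −0.8473 certified); needs +0.034 over O1, i.e. a T2-class footprint as at t′ = 0. [difficulty:
XL] -/
@[route_item "route-Ventures-M3PrimeEdgeSplitTpm1o4"]
def LowerEdgeTpm1o4_ge_m4o5 : Prop :=
  ∃ lo : ℚ, (-4/5 : ℚ) ≤ lo ∧ Summit.Ventures.CertifiedManyBodySolver.M3EnergyLowerRow (-1/4) lo

/-- item stmt-Ventures-22285 · assembly · rank 1 · open · by planner
sources: Ruelle1969, Han2020Bootstrap
[assembly] UpperEdgeTpm1o4_le_m3o4 → LowerEdgeTpm1o4_ge_m4o5 → M3Window_tpm1o4_M3prime. -/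
@[route_item "route-Ventures-M3PrimeEdgeSplitTpm1o4"]
def Assembly : Prop :=
  UpperEdgeTpm1o4_le_m3o4 → LowerEdgeTpm1o4_ge_m4o5 → Summit.Ventures.CertifiedManyBodySolver.MbsolverRungLeaves.M3Window_tpm1o4_M3prime

/-! D-0027 §2.1 — DECIDING THEOREM (planner-authored via `route open/edit --closes-file`; by planner-hubbard-m3-lines-1-g3-0 2026-08-28T06:40:47Z):
its hypotheses are this route's items and its conclusion the registered leaf `Summit.Ventures.CertifiedManyBodySolver.MbsolverRungLeaves.M3Split_tpm1o4_M3prime` (rung M3wtpm, D-0061) (glue_lint), and it elaborates with this file. -/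

@[closes "route-Ventures-M3PrimeEdgeSplitTpm1o4"] theorem closes (h₂ : UpperEdgeTpm1o4_le_m3o4) (h₃ : LowerEdgeTpm1o4_ge_m4o5) :
    Summit.Ventures.CertifiedManyBodySolver.MbsolverRungLeaves.M3Split_tpm1o4_M3prime :=
  ⟨h₃, h₂⟩

end Summit.Ventures.CertifiedManyBodySolver.Theses.M3PrimeEdgeSplitTpm1o4
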